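import Summits.Ventures.Crystal3D.Bulk.GapHullEuler
import HarnessLib

/-!
# The oriented tight map inside the hull fan of ANY admissible ambient direction set
# (route 1 of `HOME/lean/lemmaL/DESIGN.md`, steps R1.2–R1.3: the wiring made generic)

HONEST FRAMING. Part of the venture `Summits/Ventures/Crystal3D` (cell `pub-crystal3d`, phase 2;
seat p3). Kernel lemmas about an admissible fourteen-ball configuration `c` with
`intruderDist c < 3/2`; nothing here asserts anything about GAP(1.26). `Bulk/GapHullRotation.lean`
and `Bulk/GapHullEuler.lean` wire typer-bulk-2's oriented tight rotation `onextNbr` / faces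
`ofaceOf` into the hull rotation system of the FULL direction set `dirSet c`. Their proofs use
`dirSet c` only through three facts: its points are unit vectors, `0` is interior to its hull,
and every tight dart is one of its hull darts. This file re-runs them for an ARBITRARY finite
`X ⊂ S²` with those three properties (hypotheses `hX1`, `h0`, `hT`) — so that the same wiring
serves the hull fan `D°` of the ACTIVE directions (`Bulk/GapActiveHemisphere.lean`: `0` interior;
tight pairs stay exposed edges), the triangulation WITHOUT interior vertices on which LEMMA L
(faces are convex) is an ear induction:

* `IsGapConfig.hullSucc_firstReturn_onextNbr_of` — the first return of `σ_H = hullSucc X` to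
  the tight darts at a vertex is `onextNbr`;
* `tightDartsIn c X` — the tight darts inside the dart type `↥(hullDarts X)`, `α`-closed;
* `IsGapConfig.induce_rot_val_of` (`induce σ_H (tight darts) = onextNbr`),
  `IsGapConfig.phi_rot_val_of` / `phi_pow_rot_val_of` (`φ = ofaceSucc`),
  `IsGapConfig.sameCycle_phi_iff_ofaceOf_of` (same `φ`-cycle ⇔ same oriented face).
-/

noncomputable section

namespace Summit.Ventures.Crystal3D

open Literature.Geometry.DiscreteGeometry Finset Equiv HullRotSys

variable {c : Fin 14 → EuclideanSpace ℝ (Fin 3)} {X : Finset (EuclideanSpace ℝ (Fin 3))}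

/-! ## The first return of the hull rotation of an ambient set to the tight darts -/

/-- **First return of `σ_H` to the tight darts = the oriented tight rotation, for any ambient
set.** Let `c` be admissible with `intruderDist c < 3/2`, `X ⊂ S²` finite with `0` interior to
its hull, `i ≠ 0` a ball all of whose tight darts `(gapDir c i, gapDir c j)` are hull darts of
`X`, and `j` a tight partner of `i`. Then some iterate `σ_H^[n]`, `n ≥ 1`, of `hullSucc X`
carries `(gapDir c i, gapDir c j)` to `(gapDir c i, gapDir c (onextNbr c i j))`, and no earlier
positive iterate is a tight dart. -/
theorem IsGapConfig.hullSucc_firstReturn_onextNbr_of (hc : IsGapConfig c)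
    (hD : intruderDist c < 3 / 2) (hX1 : ∀ y ∈ X, ‖y‖ = 1)
    (h0 : (0 : EuclideanSpace ℝ (Fin 3)) ∈ interior (convexHull ℝ (X : Set _)))
    {i : Fin 14} (hi0 : i ≠ 0)
    (hT : ∀ j ∈ tightNbrs c i, (gapDir c i, gapDir c j) ∈ hullDarts X)
    {j : Fin 14} (hj : j ∈ tightNbrs c i) :
    ∃ n : ℕ, 0 < n ∧
      (hullSucc X)^[n] (gapDir c i, gapDir c j) = (gapDir c i, gapDir c (onextNbr c i j)) ∧
      ∀ m : ℕ, 0 < m → m < n →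
        ((hullSucc X)^[m] (gapDir c i, gapDir c j)).2 ∉ (tightNbrs c i).image (gapDir c) := by
  classical
  have hD3 := hc.sq_lt_three_of_lt hD
  have hy : ‖gapDir c i‖ = 1 := hc.norm_gapDir hi0
  -- the azimuth enumeration of the fan neighbours of `gapDir c i` in `X`
  have hfan : gapDir c j ∈ fanNbrs X (gapDir c i) := mk_mem_hullDarts_iff.1 (hT j hj)
  obtain ⟨E⟩ := nonempty_nbrEnum hX1 hy ⟨gapDir c j, hfan⟩
  -- positions of the tight partners
  obtain ⟨k, hd⟩ := hc.exists_card_tightAngles_eq_succ hD3 hi0 ⟨j, hj⟩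
  obtain ⟨m, rfl⟩ := hc.exists_tightNbrAt_eq hD3 hi0 hd hj
  have hsurj : ∀ p : Fin (k + 1), ∃ q : ℕ, q < E.d ∧ E.nb q = gapDir c (tightNbrAt c i hd p) :=
    fun p => E.surj _ (mk_mem_hullDarts_iff.1 (hT _ (tightNbrAt_mem c i hd p)))
  choose K hK using hsurj
  have hKm : K m < E.d := (hK m).1
  have hK0 : K 0 < E.d := (hK 0).1
  have hKlast : K (Fin.last k) < E.d := (hK (Fin.last k)).1
  -- the position map `K` is an order isomorphism onto the tight positions
  have hKaz : ∀ p, azimuth (gapDir c i) hy (E.nb (K p)) = sortedTightAngle c i hd p := fun p => by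
    rw [(hK p).2, ← hc.tightAzimuth_eq hi0, tightAzimuth_tightNbrAt]
  have hKlt : ∀ p q, p < q → K p < K q := by
    intro p q hpq
    by_contra hle
    rw [not_lt] at hle
    have hs : sortedTightAngle c i hd p < sortedTightAngle c i hd q :=
      (sortedTightAngle c i hd).strictMono hpq
    rw [← hKaz p, ← hKaz q] at hs
    rcases hle.lt_or_eq with hlt | heq
    · exact absurd hs (not_lt.2 (E.mono _ _ hlt (hK p).1).le)
    · rw [heq] at hs; exact lt_irrefl _ hs
  have hrefl : ∀ p q, K p < K q → p < q := by
    intro p q hpq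
    by_contra hle
    rw [not_lt] at hle
    rcases hle.lt_or_eq with hlt | heq
    · exact absurd hpq (not_lt.2 (hKlt _ _ hlt).le)
    · rw [heq] at hpq; exact lt_irrefl _ hpq
  have hrec : ∀ q, q < E.d → E.nb q ∈ (tightNbrs c i).image (gapDir c) → ∃ p : Fin (k + 1),
      K p = q := by
    intro q hq ht
    obtain ⟨j', hj', hjq⟩ := mem_image.1 ht
    obtain ⟨p, rfl⟩ := hc.exists_tightNbrAt_eq hD3 hi0 hd hj'
    refine ⟨p, E.nb_inj (hK p).1 hq ?_⟩
    rw [(hK p).2, hjq]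
  have hd0 := E.d_pos
  -- rewrite the start dart through its position
  rw [← (hK m).2]
  rcases frameDet_eq_one_or c i with hdet1 | hdetm
  · -- right-handed frame: `σ_H` and `onextNbr = nextNbr` both step FORWARD in azimuth
    have hdet : 0 < orient3 (tangentFrame (gapDir c i) hy 0) (tangentFrame (gapDir c i) hy 1)
        (tangentFrame (gapDir c i) hy 2) := by rw [← frameDet_eq hy, hdet1]; exact one_pos
    have hit := iterate_hullSucc_nb_of_det_pos hX1 h0 E hdet
    have honext : onextNbr c i (tightNbrAt c i hd m) = tightNbrAt c i hd (finRotate (k + 1) m) := by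
      unfold onextNbr; rw [if_pos hdet1, nextNbr_tightNbrAt]
    rw [honext, ← (hK (finRotate (k + 1) m)).2]
    by_cases hlast : m = Fin.last k
    · -- wrap-around: the successor is position `0`
      have hrot : finRotate (k + 1) m = 0 := by
        rw [hlast]; exact finRotate_last
      rw [hrot]
      refine ⟨E.d - K m + K 0, by omega, ?_, ?_⟩
      · rw [hit, show K m + (E.d - K m + K 0) = K 0 + E.d by omega, E.periodic]
      · intro n hn0 hn ht
        rw [hit] at ht
        simp only at ht
        by_cases hlt : K m + n < E.d
        · obtain ⟨p, hp⟩ := hrec _ hlt ht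
          have : m < p := hrefl m p (by omega)
          rw [hlast] at this
          exact absurd this (not_lt.2 (Fin.le_last p))
        · have hper : E.nb (K m + n) = E.nb (K m + n - E.d) := by
            conv_lhs => rw [show K m + n = (K m + n - E.d) + E.d by omega, E.periodic]
          rw [hper] at ht
          obtain ⟨p, hp⟩ := hrec _ (by omega) ht
          have : p < 0 := hrefl p 0 (by omega)
          exact absurd this (not_lt.2 (Fin.zero_le p))
    · -- interior: the successor is position `m + 1`
      have hval : ((finRotate (k + 1) m : Fin (k + 1)) : ℕ) = (m : ℕ) + 1 := by
        rw [finRotate_apply, Fin.val_add_one, if_neg hlast]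
      have hmlt : m < finRotate (k + 1) m := by
        rw [Fin.lt_def, hval]; exact Nat.lt_succ_self _
      have hKml : K m < K (finRotate (k + 1) m) := hKlt _ _ hmlt
      refine ⟨K (finRotate (k + 1) m) - K m, by omega, ?_, ?_⟩
      · rw [hit, Nat.add_sub_cancel' hKml.le]
      · intro n hn0 hn ht
        rw [hit] at ht
        simp only at ht
        obtain ⟨p, hp⟩ := hrec _ (by have := (hK (finRotate (k + 1) m)).1; omega) ht
        have h1 : m < p := hrefl m p (by omega)
        have h2 : p < finRotate (k + 1) m := hrefl p _ (by omega)
        rw [Fin.lt_def] at h1 h2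
        omega
  · -- left-handed frame: `σ_H` and `onextNbr = prevNbr` both step BACKWARD in azimuth
    have hne1 : frameDet c i ≠ 1 := by rw [hdetm]; norm_num
    have hdet : orient3 (tangentFrame (gapDir c i) hy 0) (tangentFrame (gapDir c i) hy 1)
        (tangentFrame (gapDir c i) hy 2) < 0 := by
      rw [← frameDet_eq hy, hdetm]; norm_num
    have hit := fun n q (h : n ≤ q) => iterate_hullSucc_nb_of_det_neg hX1 h0 E hdet (n := n) (k
        := q) h
    have honext : onextNbr c i (tightNbrAt c i hd m) =
        tightNbrAt c i hd ((finRotate (k + 1)).symm m) := by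
      unfold onextNbr; rw [if_neg hne1, prevNbr_tightNbrAt]
    set m' := (finRotate (k + 1)).symm m with hm'
    have hmm' : m = finRotate (k + 1) m' := by rw [hm', Equiv.apply_symm_apply]
    have hKm' : K m' < E.d := (hK m').1
    rw [honext, ← (hK m').2]
    -- start from the shifted index `K m + d` so that backward steps stay in `ℕ`
    have hstart : E.nb (K m) = E.nb (K m + E.d) := (E.periodic _).symm
    rw [hstart]
    by_cases hlast : m' = Fin.last k
    · -- wrap-around: `m = 0`, the predecessor is the LAST position
      have hm0 : m = 0 := by rw [hmm', hlast]; exact finRotate_last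
      refine ⟨K m + E.d - K m', by have := (hK m').1; omega, ?_, ?_⟩
      · rw [hit _ _ (by omega), show K m + E.d - (K m + E.d - K m') = K m' by
          have := (hK m').1; omega]
      · intro n hn0 hn ht
        rw [hit _ _ (by have := (hK m').1; omega)] at ht
        simp only at ht
        by_cases hge : E.d ≤ K m + E.d - n
        · have hper : E.nb (K m + E.d - n) = E.nb (K m + E.d - n - E.d) := by
            conv_lhs => rw [show K m + E.d - n = (K m + E.d - n - E.d) + E.d by omega, E.periodic]
          rw [hper] at ht
          obtain ⟨p, hp⟩ := hrec _ (by omega) ht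
          have : p < m := hrefl p m (by omega)
          rw [hm0] at this
          exact absurd this (not_lt.2 (Fin.zero_le p))
        · obtain ⟨p, hp⟩ := hrec _ (by omega) ht
          have : m' < p := hrefl m' p (by have := (hK m').1; omega)
          rw [hlast] at this
          exact absurd this (not_lt.2 (Fin.le_last p))
    · -- interior: `m = m' + 1`, the predecessor is position `m'`
      have hval : ((m : Fin (k + 1)) : ℕ) = (m' : ℕ) + 1 := by
        rw [hmm', finRotate_apply, Fin.val_add_one, if_neg hlast]
      have hm'lt : m' < m := by rw [Fin.lt_def, hval]; exact Nat.lt_succ_self _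
      have hKml : K m' < K m := hKlt _ _ hm'lt
      refine ⟨K m - K m', by omega, ?_, ?_⟩
      · rw [hit _ _ (by omega), show K m + E.d - (K m - K m') = K m' + E.d by omega, E.periodic]
      · intro n hn0 hn ht
        rw [hit _ _ (by omega), show K m + E.d - n = (K m - n) + E.d by omega, E.periodic] at ht
        simp only at ht
        obtain ⟨p, hp⟩ := hrec _ (by have := (hK m).1; omega) ht
        have h1 : m' < p := hrefl m' p (by omega)
        have h2 : p < m := hrefl p m (by omega)
        rw [Fin.lt_def] at h1 h2
        omega

/-! ## The tight darts inside the dart type of an ambient hull rotation system -/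

/-- **The tight darts inside the dart type `↥(hullDarts X)`** of an ambient set `X`. -/
def tightDartsIn (c : Fin 14 → EuclideanSpace ℝ (Fin 3)) (X : Finset (EuclideanSpace ℝ (Fin 3))) :
    Finset ↥(hullDarts X) :=
  univ.filter fun d => d.1 ∈ (darts c).image (dirPair c)

/-- Membership in `tightDartsIn`. -/
theorem mem_tightDartsIn {d : ↥(hullDarts X)} :
    d ∈ tightDartsIn c X ↔ ∃ q ∈ darts c, dirPair c q = d.1 := by
  unfold tightDartsIn
  rw [mem_filter, mem_image]
  simp only [mem_univ, true_and]

/-- The tight darts are closed under reversal. -/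
theorem isClosed_tightDartsIn (c : Fin 14 → EuclideanSpace ℝ (Fin 3))
    (X : Finset (EuclideanSpace ℝ (Fin 3))) : RotSys.IsClosed (inv X) (tightDartsIn c X) := by
  intro d hd
  obtain ⟨q, hq, hqd⟩ := mem_tightDartsIn.1 hd
  exact mem_tightDartsIn.2 ⟨q.swap, swap_mem_darts hq, by rw [dirPair_swap, hqd]; rfl⟩

/-! ## The induced rotation is `onextNbr`; its faces are the oriented faces -/

section Wiring

variable (hc : IsGapConfig c) (hD : intruderDist c < 3 / 2) (hX1 : ∀ y ∈ X, ‖y‖ = 1)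
  (h0 : (0 : EuclideanSpace ℝ (Fin 3)) ∈ interior (convexHull ℝ (X : Set _)))
  (hT : ∀ q ∈ darts c, dirPair c q ∈ hullDarts X)

include hT in
/-- Per-vertex form of the ambient hypothesis. -/
theorem tight_mem_hullDarts_of {i : Fin 14} (hi0 : i ≠ 0) :
    ∀ j ∈ tightNbrs c i, (gapDir c i, gapDir c j) ∈ hullDarts X :=
  fun j hj => hT (i, j) (mk_mem_darts hi0 hj)

include hc hD hT in
/-- **The rotation induced on the tight darts IS the oriented tight rotation**: for a tight dart
`d ↦ (i, j)`, `induce σ_H (tight darts) d ↦ (i, onextNbr c i j)`. -/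
theorem IsGapConfig.induce_rot_val_of {q : Fin 14 × Fin 14} (hq : q ∈ darts c)
    {d : ↥(hullDarts X)} (hd : d.1 = dirPair c q) :
    (RotSys.induce (rot hX1 h0) (tightDartsIn c X) d).1 = dirPair c (q.1, onextNbr c q.1 q.2) := by
  have hD2 : intruderDist c < 2 := by linarith
  have hD3 := hc.sq_lt_three_of_lt hD
  obtain ⟨hi0, hj0, hij, -⟩ := mem_darts.1 hq
  have hj : q.2 ∈ tightNbrs c q.1 := snd_mem_tightNbrs_of_mem_darts hq
  obtain ⟨n, hn0, hit, hmin⟩ :=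
    hc.hullSucc_firstReturn_onextNbr_of hD hX1 h0 hi0 (tight_mem_hullDarts_of hT hi0) hj
  have hq' : (q.1, onextNbr c q.1 q.2) ∈ darts c := mk_mem_darts hi0 (hc.onextNbr_mem hD3 hi0 hj)
  set d' : ↥(hullDarts X) := ⟨dirPair c (q.1, onextNbr c q.1 q.2), hT _ hq'⟩ with hd'
  have hdT : d ∈ tightDartsIn c X := mem_tightDartsIn.2 ⟨q, hq, hd.symm⟩
  have hd'T : d' ∈ tightDartsIn c X := mem_tightDartsIn.2 ⟨_, hq', rfl⟩
  have hpow : (rot hX1 h0 ^ n) d = d' := by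
    apply Subtype.ext
    rw [rot_pow_apply_val, hd]
    exact hit
  have hnot : ∀ m, 0 < m → m < n → (rot hX1 h0 ^ m) d ∉ tightDartsIn c X := by
    intro m hm0 hmn hmem
    obtain ⟨q', hq'd, hq'e⟩ := mem_tightDartsIn.1 hmem
    rw [rot_pow_apply_val, hd] at hq'e
    -- the tail of the iterate is `gapDir c q.1`, so `q'.1 = q.1` and the head is a tight direction
    have hfst : gapDir c q'.1 = gapDir c q.1 := by
      have := congrArg Prod.fst hq'e
      rw [iterate_hullSucc_fst] at this
      exact this
    have hq'1 : q'.1 = q.1 := hc.eq_of_gapDir_eq hD2 (mem_darts.1 hq'd).1 hi0 hfst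
    apply hmin m hm0 hmn
    have hq'e' : (hullSucc X)^[m] (gapDir c q.1, gapDir c q.2) = dirPair c q' := hq'e.symm
    rw [hq'e']
    exact mem_image.2 ⟨q'.2, hq'1 ▸ snd_mem_tightNbrs_of_mem_darts hq'd, rfl⟩
  have h := RotSys.induce_eq_of_first_return (rot hX1 h0) hdT hn0 hpow hd'T hnot
  rw [h]

include hc hD hT in
/-- **The induced face permutation IS the oriented face successor `φ°`**: for a tight dart
`d ↦ q`, `phi σ_H (tight darts) d ↦ ofaceSucc c q`. -/
theorem IsGapConfig.phi_rot_val_of {q : Fin 14 × Fin 14} (hq : q ∈ darts c)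
    {d : ↥(hullDarts X)} (hd : d.1 = dirPair c q) :
    (RotSys.phi (rot hX1 h0) (inv X) (tightDartsIn c X) d).1 = dirPair c (ofaceSucc c q) := by
  rw [RotSys.phi_apply]
  have hd' : (inv X d).1 = dirPair c q.swap := by
    rw [inv_apply_val, hd, dirPair_swap]
  rw [hc.induce_rot_val_of hD hX1 h0 hT (swap_mem_darts hq) hd']
  rfl

include hc hD hT in
/-- Iterates: `phi^n d ↦ φ°^[n] q`. -/
theorem IsGapConfig.phi_pow_rot_val_of {q : Fin 14 × Fin 14} (hq : q ∈ darts c)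
    {d : ↥(hullDarts X)} (hd : d.1 = dirPair c q) (n : ℕ) :
    ((RotSys.phi (rot hX1 h0) (inv X) (tightDartsIn c X) ^ n) d).1 =
      dirPair c ((ofaceSucc c)^[n] q) := by
  induction n with
  | zero => exact hd
  | succ n ih =>
    rw [pow_succ', Perm.mul_apply, Function.iterate_succ_apply']
    exact hc.phi_rot_val_of hD hX1 h0 hT
      (hc.iterate_ofaceSucc_mem_darts (hc.sq_lt_three_of_lt hD) hq n) ih

include hc hD hT in
/-- **Same face cycle ⇔ same oriented face.** -/
theorem IsGapConfig.sameCycle_phi_iff_ofaceOf_of {q q' : Fin 14 × Fin 14} (hq : q ∈ darts c)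
    (hq' : q' ∈ darts c) {d d' : ↥(hullDarts X)} (hd : d.1 = dirPair c q)
    (hd' : d'.1 = dirPair c q') :
    (RotSys.phi (rot hX1 h0) (inv X) (tightDartsIn c X)).SameCycle d d' ↔
      ofaceOf c q = ofaceOf c q' := by
  have hD2 : intruderDist c < 2 := by linarith
  have hD3 := hc.sq_lt_three_of_lt hD
  have hper := hc.mem_periodicPts_ofaceSucc hD3 hq
  constructor
  · intro h
    obtain ⟨n, -, hn⟩ := h.exists_pow_eq'
    have hval := congrArg Subtype.val hn
    rw [hc.phi_pow_rot_val_of hD hX1 h0 hT hq hd n, hd'] at hval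
    have heq : (ofaceSucc c)^[n] q = q' :=
      hc.dirPair_injOn hD2 (Finset.mem_coe.2 (hc.iterate_ofaceSucc_mem_darts hD3 hq n))
        (Finset.mem_coe.2 hq') hval
    exact (ofaceOf_eq_of_mem hper ((mem_ofaceOf_iff hper).2 ⟨n, heq⟩)).symm
  · intro h
    have hmem : q' ∈ ofaceOf c q := by
      rw [h]; exact self_mem_ofaceOf (hc.mem_periodicPts_ofaceSucc hD3 hq')
    obtain ⟨n, hn⟩ := (mem_ofaceOf_iff hper).1 hmem
    refine ⟨(n : ℤ), ?_⟩
    rw [zpow_natCast]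
    apply Subtype.ext
    rw [hc.phi_pow_rot_val_of hD hX1 h0 hT hq hd n, hn, hd']

end Wiring

end Summit.Ventures.Crystal3D
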